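import Summits.BirchSwinnertonDyer.BirchSwinnertonDyer.Theorems.AdditiveBranchIMCGordTwoRankZeroOffCaseOneFieldSupplyR0Aux
import Summits.BirchSwinnertonDyer.BirchSwinnertonDyer.Theorems.AdditiveBranchIMCGordTwoRankZeroOffCaseOneFieldSupplyR0Local
import Summits.BirchSwinnertonDyer.BirchSwinnertonDyer.Theorems.AdditiveBranchIMCGordTwoRankZeroOffCaseOneFieldSupplyR0Partner
import Summits.BirchSwinnertonDyer.BirchSwinnertonDyer.Theorems.AdditiveBranchIMCGordTwoRankZeroOffCaseOneFieldSupplyR0Arith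
import Literature.NumberTheory.QuadraticFields.FundamentalDiscriminant
import Literature.NumberTheory.EllipticCurves.NonvanishingTwistsPrescribedRamificationOfHoffsteinLuoProofs
import Literature.NumberTheory.EllipticCurves.NonvanishingTwistsProofs
import Literature.NumberTheory.EllipticCurves.LFunctionSmulProofs
import HarnessLib

/-!
# LANDING-READY (F2₂): the genus-class FIELD TWO over a road field in which `2` RAMIFIES (pen bsd-addord-plan gen 44, 2026-08-30; crux workfile of
19357 `GordTwoRankZeroOffCaseOne`, NOT a Theorems file — the pen never proposes)

= §1–§5 of the pen's checked workfile `WanAnyFieldTwoR0.lean` v2 (b8469de9518d; TARGET E356 (a)–(e), E357) with the namespace moved to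
`…Theorems.WanAnyRoad` (so that `fieldTwoTwo_supply` lands next to `WanAnyRoadR0Landing.lean`'s `def FieldTwoTwo`, whose body it restates verbatim) and
§6 DROPPED (= stub-1's p777579 `TwistRootNumberDyadic.fieldOneTwoR0_of_engineTwo`). Contents: §1 `genusFactor_two_spec` (d_K = e₂·δ, e₂ ∈ {−4, 8, −8});
§2 `exists_prime_star_prescribed_of_emod_four` / `exists_prime_star_prescribed_two` (Dirichlet prime with `(p*·δ·ℓ₀*) ≡ 1 (mod 8)`); §3 `exists_auxTwist_two`;
§4 `exists_ramifiedClass_partner_two` (`D = p*·e₂·ℓ₀*·d` EVEN fundamental, `2` ramified in `K''`); §5 `exists_fieldTwo_gordTwo_two` and the typed supply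
`fieldTwoTwo_supply` (statement = the body of `FieldTwoTwo`). A prover lands it verbatim as, e.g.,
`Theorems/AdditiveBranchIMCGordTwoRankZeroOffCaseOneFieldSupplyTwoR0.lean` (`--supports stmt-BirchSwinnertonDyer-19357 --as helper`); imports are built Theorems
(`…FieldSupplyR0{Aux,Local,Partner,Arith}`) and Literature modules only. lean rc 0, 0 sorries. BSD is proved for no curve by any of this.
[cite: FriedbergHoffstein1995, Theorem B] [cite: HoffsteinLuo1997, Theorem] [cite: SilvermanAEC2009, VII.5.4 and App. C §16]
-/

set_option linter.dupNamespace false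

noncomputable section

open scoped Classical

open WeierstrassCurve NumberField IsDedekindDomain Rat.HeightOneSpectrum
  Literature.NumberTheory.EllipticCurves
  Literature.NumberTheory.EllipticCurves.ModularForms
  Literature.NumberTheory.EllipticCurves.Rank1Residual
  Literature.NumberTheory.QuadraticFields
  Summit.BirchSwinnertonDyer.Rank1Residual
  Summit.BirchSwinnertonDyer.Rank1Residual.Additive

namespace Summit.BirchSwinnertonDyer.BirchSwinnertonDyer.Theorems.WanAnyRoad

open NumberTheorySymbols ZMod
open Summit.BirchSwinnertonDyer.BirchSwinnertonDyer.Theorems.ThreeFieldRoadSupply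
open Summit.BirchSwinnertonDyer.BirchSwinnertonDyer.Theorems.AdditiveKoly.RamifiedHabitat (pStar_emod_four eq_of_prime_dvd_pStar)
open Literature.NumberTheory.EllipticCurves.Castella2018.TamagawaQuadratic

/-! ### §1 The genus factorisation of an EVEN road-field discriminant (E356 (a)) -/

section GenusFactorTwo

variable {p : ℕ} [hp : Fact p.Prime] (W : WeierstrassCurve ℚ) (K : Type) [Field K] [NumberField K]

/-- **The genus factor of a road field in which `2` ramifies.** For `K` imaginary quadratic with `2 ∣ d_K`, every ODD prime
`ℓ ∣ N_E` split in `K`, and `p ∣ N_E` odd: `d_K = e₂·δ₁` with `e₂ ∈ {−4, 8, −8}`, `δ₁ ≡ 1 (mod 4)`, `δ₁` square-free and odd,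
`p ∤ δ₁`, and no prime of `δ₁` divides `N_E`. [cite: Cox2013, §1.C Lemma 1.14 (genus factorisation of a discriminant)] -/
theorem genusFactor_two_spec (hK : IsImaginaryQuadratic K) (h2d : (2 : ℤ) ∣ NumberField.discr K)
    (hsplit : ∀ ℓ : ℕ, ℓ.Prime → ℓ ∣ W.conductorNorm ℤ → ℓ ≠ 2 →
      ((Ideal.span {(ℓ : ℤ)}).primesOver (𝓞 K)).ncard = 2)
    (hpN : p ∣ W.conductorNorm ℤ) :
    ∃ e₂ δ : ℤ, (e₂ = -4 ∨ e₂ = 8 ∨ e₂ = -8) ∧ NumberField.discr K = e₂ * δ ∧ δ % 4 = 1 ∧ Squarefree δ ∧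
      ¬ (2 : ℤ) ∣ δ ∧ ¬ (p : ℤ) ∣ δ ∧
      (∀ ℓ : ℕ, ℓ.Prime → (ℓ : ℤ) ∣ δ → ¬ ℓ ∣ W.conductorNorm ℤ) := by
  set d : ℤ := NumberField.discr K with hd
  -- primes of an odd divisor of `d_K` are good primes of `E` (an odd bad prime splits, hence does not ramify)
  have hgood : ∀ δ : ℤ, δ ∣ d → ¬ (2 : ℤ) ∣ δ → ∀ ℓ : ℕ, ℓ.Prime → (ℓ : ℤ) ∣ δ → ¬ ℓ ∣ W.conductorNorm ℤ := by
    intro δ hδd hδ2 ℓ hℓ hℓδ hℓN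
    have hℓd : (ℓ : ℤ) ∣ d := hℓδ.trans hδd
    have hℓ2 : ℓ ≠ 2 := by rintro rfl; exact hδ2 (by exact_mod_cast hℓδ)
    have hs := hsplit ℓ hℓ hℓN hℓ2
    exact Literature.SatisfiesHeegnerHypothesis.not_dvd_discr hK.1
      (N := ℓ) (fun r hr hrℓ ↦ by rwa [(Nat.prime_dvd_prime_iff_eq hr hℓ).mp hrℓ]) hℓ dvd_rfl hℓd
  have hsqneg : ∀ x : ℤ, Squarefree x → Squarefree (-x) := fun x hx ↦
    Int.squarefree_natAbs.mp (by rw [Int.natAbs_neg]; exact Int.squarefree_natAbs.mpr hx)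
  rcases Literature.NumberTheory.QuadraticFields.Quadratic.isFundamentalDiscriminant_discr (K := K) hK.1 with
    ⟨h1, -, -⟩ | ⟨h4, hm4, hsqm⟩
  · exfalso
    rw [← hd] at h1
    have : (2 : ℤ) ∣ d := h2d
    omega
  · rw [← hd] at h4 hm4 hsqm
    set m : ℤ := d / 4 with hm
    have hdm : d = 4 * m := by rw [hm]; exact (Int.mul_ediv_cancel' h4).symm
    rcases hm4 with hm2 | hm3
    · -- `m = 2 m'` with `m'` odd: `e₂ = ±8`, `δ₁ = ±m'`
      set m' : ℤ := m / 2 with hm'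
      have hmm' : m = 2 * m' := by omega
      have hsqm' : Squarefree m' := hsqm.squarefree_of_dvd ⟨2, by rw [hmm']; ring⟩
      by_cases h1 : m' % 4 = 1
      · have hδd : m' ∣ d := ⟨8, by rw [hdm, hmm']; ring⟩
        have hδ2 : ¬ (2 : ℤ) ∣ m' := by omega
        exact ⟨8, m', Or.inr (Or.inl rfl), by rw [hdm, hmm']; ring, h1, hsqm', hδ2,
          fun h ↦ hgood m' hδd hδ2 p hp.out h hpN, hgood m' hδd hδ2⟩
      · have hδd : -m' ∣ d := ⟨-8, by rw [hdm, hmm']; ring⟩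
        have hδ2 : ¬ (2 : ℤ) ∣ -m' := by omega
        exact ⟨-8, -m', Or.inr (Or.inr rfl), by rw [hdm, hmm']; ring, by omega, hsqneg m' hsqm', hδ2,
          fun h ↦ hgood (-m') hδd hδ2 p hp.out h hpN, hgood (-m') hδd hδ2⟩
    · -- `m ≡ 3 (mod 4)`: `e₂ = −4`, `δ₁ = −m`
      have hδd : -m ∣ d := ⟨-4, by rw [hdm]; ring⟩
      have hδ2 : ¬ (2 : ℤ) ∣ -m := by omega
      exact ⟨-4, -m, Or.inl rfl, by rw [hdm]; ring, by omega, hsqneg m hsqm, hδ2,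
        fun h ↦ hgood (-m) hδd hδ2 p hp.out h hpN, hgood (-m) hδd hδ2⟩

end GenusFactorTwo

/-! ### §2 The Dirichlet prime for any modulus factor `m ≡ 1 (mod 4)` (E356 (b)) -/


/-- **A Dirichlet prime with prescribed sign, prescribed Legendre symbols, and `m·ℓ₀* ≡ 1 (mod 8)` for any `m ≡ 1 (mod 4)`**
(generalises `exists_prime_star_prescribed`, whose `m = p*q*`). [folklore: CRT + Dirichlet; cite: IrelandRosen1990, Ch. 5 §2] -/
theorem exists_prime_star_prescribed_of_emod_four {m : ℤ} (hm4 : m % 4 = 1)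
    {σ : ℤ} (hσ : σ = 1 ∨ σ = -1) (S : Finset ℕ) (hS : ∀ ℓ ∈ S, ℓ.Prime ∧ ℓ ≠ 2)
    (η : ℕ → ℤ) (hη : ∀ ℓ ∈ S, η ℓ = 1 ∨ η ℓ = -1) (B : ℕ) :
    ∃ ℓ₀ : ℕ, ℓ₀.Prime ∧ B < ℓ₀ ∧ ((-1 : ℤ) ^ (ℓ₀ / 2)) = σ ∧
      (m * ((-1 : ℤ) ^ (ℓ₀ / 2) * ℓ₀)) % 8 = 1 ∧
      ∀ ℓ ∈ S, J((-1 : ℤ) ^ (ℓ₀ / 2) * ℓ₀ | ℓ) = η ℓ := by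
  have hm2 : m % 2 = 1 := by omega
  -- the class modulo `8`
  set c : ℕ := ((σ * m) % 8).toNat with hc
  have hc0 : (0 : ℤ) ≤ (σ * m) % 8 := Int.emod_nonneg _ (by norm_num)
  have hcZ : (c : ℤ) = (σ * m) % 8 := by rw [hc, Int.toNat_of_nonneg hc0]
  have hσm2 : (σ * m) % 2 = 1 := by rcases hσ with rfl | rfl <;> omega
  have hc2 : c % 2 = 1 := by
    have : (c : ℤ) % 2 = 1 := by rw [hcZ]; omega
    omega
  have hc4 : (c : ℤ) % 4 = if σ = 1 then 1 else 3 := by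
    rw [hcZ]
    rcases hσ with rfl | rfl
    · simp only [if_true]; omega
    · simp only [show (-1 : ℤ) ≠ 1 by decide, if_false]; omega
  -- the prescribed residues, corrected by `J((−1)^{(c−1)/2} | ℓ)`
  set s : ℤ := (-1 : ℤ) ^ (c / 2) with hs
  have hs1 : s = 1 ∨ s = -1 := neg_one_pow_eq_or ℤ _
  have hsℓ : ∀ ℓ ∈ S, J(s | ℓ) = 1 ∨ J(s | ℓ) = -1 := fun ℓ hℓ ↦ by
    refine jacobiSym.eq_one_or_neg_one ?_
    rcases hs1 with h | h <;> rw [h] <;> simp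
  obtain ⟨ℓ₀, hℓ₀, hBℓ₀, hℓ₀8, hJ⟩ := exists_prime_jacobiSym_prescribed S hS (fun ℓ ↦ J(s | ℓ) * η ℓ)
    (fun ℓ hℓ ↦ by
      rcases hsℓ ℓ hℓ with h | h <;> rcases hη ℓ hℓ with h' | h' <;> rw [h, h'] <;> norm_num) c hc2 B
  have hℓ₀odd : ℓ₀ % 2 = 1 := by omega
  -- `(−1)^{(ℓ₀−1)/2} = (−1)^{(c−1)/2} = σ`
  have hstar : ((-1 : ℤ) ^ (ℓ₀ / 2)) = s := by
    rw [hs, ← ZMod.χ₄_eq_neg_one_pow hℓ₀odd, ← ZMod.χ₄_eq_neg_one_pow hc2, ZMod.χ₄_nat_mod_four,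
      ZMod.χ₄_nat_mod_four (n := c)]
    congr 2
    omega
  have hsσ : s = σ := by
    rw [hs, ← ZMod.χ₄_eq_neg_one_pow hc2, ZMod.χ₄_nat_eq_if_mod_four]
    simp only [hc2, one_ne_zero, if_false]
    rcases hσ with rfl | rfl
    · simp only [if_true] at hc4
      rw [if_pos (by omega)]
    · simp only [show (-1 : ℤ) ≠ 1 by decide, if_false] at hc4
      rw [if_neg (by omega)]
  refine ⟨ℓ₀, hℓ₀, hBℓ₀, hstar.trans hsσ, ?_, fun ℓ hℓ ↦ ?_⟩
  · -- `m · (σ ℓ₀) ≡ m σ σ m = m² ≡ 1 (mod 8)`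
    rw [hstar, hsσ]
    have hℓ₀Z : (ℓ₀ : ℤ) % 8 = (σ * m) % 8 := by
      have h1 : (ℓ₀ : ℤ) % 8 = (c : ℤ) % 8 := by exact_mod_cast hℓ₀8
      rw [h1, hcZ, Int.emod_emod_of_dvd _ (dvd_refl (8 : ℤ))]
    have hσσ : σ * σ = 1 := by rcases hσ with rfl | rfl <;> norm_num
    calc (m * (σ * (ℓ₀ : ℤ))) % 8 = ((m * σ) * (ℓ₀ : ℤ)) % 8 := by congr 1; ring
      _ = ((m * σ) % 8) * ((ℓ₀ : ℤ) % 8) % 8 := Int.mul_emod _ _ _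
      _ = ((m * σ) % 8) * ((σ * m) % 8) % 8 := by rw [hℓ₀Z]
      _ = ((m * σ) * (σ * m)) % 8 := (Int.mul_emod _ _ _).symm
      _ = (m * m) % 8 := by rw [show m * σ * (σ * m) = (σ * σ) * (m * m) by ring, hσσ, one_mul]
      _ = 1 := Int.mul_self_emod_eight_of_odd hm2
  · rw [hstar, jacobiSym.mul_left, hJ ℓ hℓ, ← mul_assoc, ← sq]
    rcases hsℓ ℓ hℓ with h | h <;> rw [h] <;> norm_num

/-- **The Dirichlet prime at the Wan prime `2`** (E356 (b) as used in (c)): for an odd prime `p` and an odd genus factor `δ ≡ 1 (mod 4)`,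
a prime `ℓ₀ > B` with prescribed sign and Legendre symbols and `p*·δ·ℓ₀* ≡ 1 (mod 8)`. -/
theorem exists_prime_star_prescribed_two {p : ℕ} (hp : p.Prime) (hp2 : p ≠ 2) {δ : ℤ} (hδ4 : δ % 4 = 1)
    {σ : ℤ} (hσ : σ = 1 ∨ σ = -1) (S : Finset ℕ) (hS : ∀ ℓ ∈ S, ℓ.Prime ∧ ℓ ≠ 2)
    (η : ℕ → ℤ) (hη : ∀ ℓ ∈ S, η ℓ = 1 ∨ η ℓ = -1) (B : ℕ) :
    ∃ ℓ₀ : ℕ, ℓ₀.Prime ∧ B < ℓ₀ ∧ ((-1 : ℤ) ^ (ℓ₀ / 2)) = σ ∧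
      (((-1 : ℤ) ^ (p / 2) * p) * δ * ((-1 : ℤ) ^ (ℓ₀ / 2) * ℓ₀)) % 8 = 1 ∧
      ∀ ℓ ∈ S, J((-1 : ℤ) ^ (ℓ₀ / 2) * ℓ₀ | ℓ) = η ℓ := by
  -- `p* ≡ 1 (mod 4)` (verbatim from `exists_prime_star_prescribed`)
  have hpodd : (p : ℤ) % 2 = 1 := by exact_mod_cast Nat.odd_iff.mp (hp.eq_two_or_odd'.resolve_left hp2)
  have hps4 : ((-1 : ℤ) ^ (p / 2) * p) % 4 = 1 := by
    have hp4 : (p : ℤ) % 4 = 1 ∨ (p : ℤ) % 4 = 3 := by omega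
    have : ((-1 : ℤ) ^ (p / 2)) = if p % 4 = 1 then 1 else -1 := by
      rw [← ZMod.χ₄_eq_neg_one_pow (by exact_mod_cast hpodd), ZMod.χ₄_nat_eq_if_mod_four]
      simp only [show p % 2 = 1 by exact_mod_cast hpodd, one_ne_zero, if_false]
    rw [this]
    split_ifs with h4
    · omega
    · have : (p : ℤ) % 4 = 3 := by omega
      rw [Int.mul_emod, this]; decide
  have hm4 : (((-1 : ℤ) ^ (p / 2) * p) * δ) % 4 = 1 := by
    rw [Int.mul_emod, hps4, hδ4]; decide
  exact exists_prime_star_prescribed_of_emod_four hm4 hσ S hS η hη B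


/-! ### §3 The auxiliary twist of root number `−1` at the Wan prime `2` (E356 (c)) -/

section AuxTwistTwo

variable (W : WeierstrassCurve ℚ) [W.IsElliptic] [W.IsGloballyMinimal] (p : ℕ) [hp : Fact p.Prime]
  (K : Type) [Field K] [NumberField K]

set_option maxHeartbeats 800000 in
/-- **FIELD 2 at the Wan prime `2`, step 1 — the auxiliary twist of root number `−1`** (the `q = 2` port of `exists_auxTwist`).
For `(E, p)` on the (G-ord, `e = 2`) cell with `p ≥ 5`, `w(E) = +1`, and a road field `K` with `2 ∣ d_K` (the Wan prime `2`
RAMIFIED) and every ODD bad prime split: the good-ordinary partner `V` (`E ≅ V^{(p*)}`), the genus factorisation `d_K = e₂·δ₁`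
(`e₂ ∈ {−4, 8, −8}`, `δ₁ ≡ 1 (mod 4)` odd), a Dirichlet prime `ℓ₀` outside `2·N_E·M₀·d_K` with `(ℓ₀*/ℓ) = (p*e₂/ℓ)` at the odd primes
`ℓ ≠ p` of `N_E M₀` and the IMPOSED congruence `p*·δ₁·ℓ₀* ≡ 1 (mod 8)`, and a globally minimal `X ≅ V^{(T)}`, `T = δ₁ℓ₀*`, with
`T ≡ 1 (mod 4)`, `p*T < 0`, `(p*T/ℓ) = 1` at the odd primes of `N_V`, `p*T ≡ 1 (mod 8)` (unconditionally), and `w(X) = −1`.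
[cite: SilvermanAEC2009, X.5 Cor. 5.4 and App. C §16] [cite: IrelandRosen1990, Ch. 16 §1] [cite: Cox2013, §1.C Lemma 1.14] -/
theorem exists_auxTwist_two
    (hmod : exists_isNewformOf) (hp5 : 5 ≤ p) (hw : W.rootNumber = 1) (hcell : N10.CellGordTwo W p)
    (hK : IsImaginaryQuadratic K) (h2d : (2 : ℤ) ∣ NumberField.discr K)
    (hsplit : ∀ ℓ : ℕ, ℓ.Prime → ℓ ∣ W.conductorNorm ℤ → ℓ ≠ 2 →
      ((Ideal.span {(ℓ : ℤ)}).primesOver (𝓞 K)).ncard = 2) (M₀ : ℕ) (hM₀ : M₀ ≠ 0) :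
    ∃ (V : WeierstrassCurve ℚ) (_ : V.IsElliptic) (_ : V.IsGloballyMinimal) (C' : VariableChange ℚ)
      (e₂ δ : ℤ) (ℓ₀ : ℕ) (X : WeierstrassCurve ℚ) (_ : X.IsElliptic) (_ : X.IsGloballyMinimal)
      (CX : VariableChange ℚ),
      C' • V.quadraticTwist ((-1 : ℚ) ^ (p / 2) * p) = W ∧ GoodOrd V p ∧
      W.conductorNorm ℤ = V.conductorNorm ℤ * p ^ 2 ∧
      (e₂ = -4 ∨ e₂ = 8 ∨ e₂ = -8) ∧ NumberField.discr K = e₂ * δ ∧ δ % 4 = 1 ∧ Squarefree δ ∧ ¬ (2 : ℤ) ∣ δ ∧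
      ¬ (p : ℤ) ∣ δ ∧ δ ≠ 0 ∧
      ℓ₀.Prime ∧ ℓ₀ ≠ p ∧ ℓ₀ ≠ 2 ∧ ¬ ℓ₀ ∣ W.conductorNorm ℤ * M₀ ∧ ¬ (ℓ₀ : ℤ) ∣ δ ∧ ¬ (ℓ₀ : ℤ) ∣ NumberField.discr K ∧
      (((-1 : ℤ) ^ (p / 2) * p) * δ * ((-1 : ℤ) ^ (ℓ₀ / 2) * ℓ₀)) % 8 = 1 ∧
      (∀ ℓ : ℕ, ℓ.Prime → ℓ ∣ W.conductorNorm ℤ * M₀ → ℓ ≠ 2 → ℓ ≠ p →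
        J((-1 : ℤ) ^ (ℓ₀ / 2) * ℓ₀ | ℓ) = J(((-1 : ℤ) ^ (p / 2) * p) * e₂ | ℓ)) ∧
      (δ * ((-1 : ℤ) ^ (ℓ₀ / 2) * ℓ₀)) % 4 = 1 ∧
      ((-1 : ℤ) ^ (p / 2) * p) * (δ * ((-1 : ℤ) ^ (ℓ₀ / 2) * ℓ₀)) < 0 ∧
      (∀ ℓ : ℕ, ℓ.Prime → ℓ ∣ V.conductorNorm ℤ → ℓ ≠ 2 →
        J(((-1 : ℤ) ^ (p / 2) * p) * (δ * ((-1 : ℤ) ^ (ℓ₀ / 2) * ℓ₀)) | ℓ) = 1) ∧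
      (((-1 : ℤ) ^ (p / 2) * p) * (δ * ((-1 : ℤ) ^ (ℓ₀ / 2) * ℓ₀))) % 8 = 1 ∧
      CX • X = V.quadraticTwist ((δ * ((-1 : ℤ) ^ (ℓ₀ / 2) * ℓ₀) : ℤ) : ℚ) ∧ X.rootNumber = -1 := by
  have hp2 : p ≠ 2 := by omega
  -- notation
  set ps : ℤ := (-1 : ℤ) ^ (p / 2) * p with hps
  set dK : ℤ := NumberField.discr K with hdK
  have hdK0 : dK ≠ 0 := NumberField.discr_ne_zero K
  have hdKneg : dK < 0 := hK.discr_neg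
  -- the bad primes
  have hpN : p ∣ W.conductorNorm ℤ :=
    (W.dvd_conductorNorm_iff_not_hasGoodReductionAtPrime p).mpr hcell.2.1.1
  have hNW0 : W.conductorNorm ℤ ≠ 0 := (W.conductorNorm_pos_holds).ne'
  -- §a the good-ordinary partner `V`
  obtain ⟨V, iV, iVm, CV, hCV, hordV, ⟨C', hC'⟩, hNWV, hpNV, hrootW⟩ :=
    exists_goodOrd_partner_rootNumber W p hmod hp5 hcell
  have hNV0 : V.conductorNorm ℤ ≠ 0 := (V.conductorNorm_pos_holds).ne'
  have hNVW : V.conductorNorm ℤ ∣ W.conductorNorm ℤ := ⟨p ^ 2, hNWV⟩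
  -- §b the genus factorisation `d_K = e₂ δ₁`
  obtain ⟨e₂, δ, he₂, hfac, hδ4, hδsq, hδ2, hpδ, hδgood⟩ := genusFactor_two_spec (p := p) W K hK h2d hsplit hpN
  rw [← hdK] at hfac
  have h2dK : (2 : ℤ) ∣ dK := by rw [hdK]; exact h2d
  -- make `d_K` opaque (its value is never unfolded again; this keeps `isDefEq` cheap)
  clear_value dK
  have hδ0 : δ ≠ 0 := by rintro h; rw [h, mul_zero] at hfac; exact hdK0 hfac
  have hpsδ0 : ps * δ ≠ 0 := mul_ne_zero (by
    rw [hps]; exact mul_ne_zero (pow_ne_zero _ (by norm_num)) (by exact_mod_cast hp.out.ne_zero)) hδ0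
  have he₂8 : e₂ ∣ 8 := by rcases he₂ with h | h | h <;> rw [h] <;> norm_num
  -- §c the auxiliary prime `ℓ₀`
  set σ : ℤ := - Int.sign (ps * δ) with hσ
  have hσ1 : σ = 1 ∨ σ = -1 := by
    rcases lt_trichotomy (ps * δ) 0 with h | h | h
    · left; rw [hσ, Int.sign_eq_neg_one_of_neg h]; norm_num
    · exact (hpsδ0 h).elim
    · right; rw [hσ, Int.sign_eq_one_of_pos h]
  set M : ℕ := W.conductorNorm ℤ * M₀ with hM
  have hM0 : M ≠ 0 := mul_ne_zero hNW0 hM₀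
  set Scrt : Finset ℕ := M.primeFactors.erase 2 with hScrt
  have hScrt_mem : ∀ ℓ, ℓ ∈ Scrt ↔ ℓ.Prime ∧ ℓ ∣ M ∧ ℓ ≠ 2 := fun ℓ ↦ by
    rw [hScrt, Finset.mem_erase, Nat.mem_primeFactors]; tauto
  set η : ℕ → ℤ := fun ℓ ↦ if ℓ = p then 1 else J(ps * e₂ | ℓ) with hη
  have hη1 : ∀ ℓ ∈ Scrt, η ℓ = 1 ∨ η ℓ = -1 := by
    intro ℓ hℓ
    obtain ⟨hℓp, -, hℓ2⟩ := (hScrt_mem ℓ).mp hℓ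
    simp only [hη]
    split_ifs with h1
    · exact Or.inl rfl
    · have hnd : ¬ (ℓ : ℤ) ∣ ps * e₂ := by
        intro hd
        rcases Int.Prime.dvd_mul' hℓp hd with hd | hd
        · exact h1 (eq_of_prime_dvd_pStar (p := p) hℓp hd)
        · have h8 : (ℓ : ℤ) ∣ 8 := hd.trans he₂8
          have h8' : ℓ ∣ 2 ^ 3 := by exact_mod_cast h8
          exact hℓ2 ((Nat.prime_dvd_prime_iff_eq hℓp Nat.prime_two).mp (hℓp.dvd_of_dvd_pow h8'))
      rcases jacobiSym.trichotomy (ps * e₂) ℓ with h0 | h0 | h0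
      · exfalso
        have := jacobiSym_mul_self_eq_one hℓp hnd
        rw [h0, mul_zero] at this
        exact zero_ne_one this
      · exact Or.inl h0
      · exact Or.inr h0
  set B : ℕ := M * dK.natAbs with hB
  obtain ⟨ℓ₀, hℓ₀, hBℓ₀, hσℓ₀, h8ℓ₀, hJℓ₀⟩ :=
    exists_prime_star_prescribed_two hp.out hp2 hδ4 hσ1
      Scrt (fun ℓ hℓ ↦ ⟨((hScrt_mem ℓ).mp hℓ).1, ((hScrt_mem ℓ).mp hℓ).2.2⟩) η hη1 B
  set ls : ℤ := (-1 : ℤ) ^ (ℓ₀ / 2) * ℓ₀ with hls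
  -- `ℓ₀` is large: it divides neither `M = N_E M₀` nor `d_K`, and `ℓ₀ ∉ {2, p}`
  have hB0 : B ≠ 0 := mul_ne_zero hM0 (Int.natAbs_ne_zero.mpr hdK0)
  have hℓ₀M : ¬ ℓ₀ ∣ M := fun h ↦ by
    have := Nat.le_of_dvd (Nat.pos_of_ne_zero hM0) h
    have : M ≤ B := Nat.le_mul_of_pos_right M (Nat.pos_of_ne_zero (Int.natAbs_ne_zero.mpr hdK0))
    omega
  have hℓ₀dK : ¬ (ℓ₀ : ℤ) ∣ dK := fun h ↦ by
    have h' : ℓ₀ ∣ dK.natAbs := by simpa using Int.natAbs_dvd_natAbs.mpr h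
    have := Nat.le_of_dvd (Nat.pos_of_ne_zero (Int.natAbs_ne_zero.mpr hdK0)) h'
    have : dK.natAbs ≤ B := Nat.le_mul_of_pos_left _ (Nat.pos_of_ne_zero hM0)
    omega
  have hℓ₀NW : ¬ ℓ₀ ∣ W.conductorNorm ℤ := fun h ↦ hℓ₀M (h.mul_right _)
  have hℓ₀M₀ : ¬ ℓ₀ ∣ M₀ := fun h ↦ hℓ₀M (h.mul_left _)
  have hℓ₀p : ℓ₀ ≠ p := fun h ↦ hℓ₀NW (h ▸ hpN)
  have hℓ₀2 : ℓ₀ ≠ 2 := by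
    rintro rfl
    exact hℓ₀dK (by exact_mod_cast h2dK)
  have hℓ₀δ : ¬ (ℓ₀ : ℤ) ∣ δ := fun h ↦ hℓ₀dK (h.trans ⟨e₂, by rw [mul_comm]; exact hfac⟩)
  have hℓ₀odd : ℓ₀ % 2 = 1 := Nat.odd_iff.mp (hℓ₀.eq_two_or_odd'.resolve_left hℓ₀2)
  have hls4 : ls % 4 = 1 := (haveI := Fact.mk hℓ₀; pStar_emod_four (p := ℓ₀) hℓ₀2)
  have hps4 : ps % 4 = 1 := pStar_emod_four (p := p) hp2
  -- §d the auxiliary twist `T = δ₁ ℓ₀*` and `X ≅ V^{(T)}` with `w(X) = −1`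
  set T : ℤ := δ * ls with hT
  have hT4 : T % 4 = 1 := by
    rw [hT, Int.mul_emod, hδ4, hls4]; decide
  have hT0 : T ≠ 0 := by rintro h; rw [h] at hT4; norm_num at hT4
  have hTq : (T : ℚ) ≠ 0 := by exact_mod_cast hT0
  -- the sign hypotheses of `jacobiSym_rootNumber_sign`
  have hVroot : V.rootNumber = 1 ∨ V.rootNumber = -1 := V.rootNumber_eq_one_or
  have h1 : J(-1 | p) * J((V.conductorNorm ℤ : ℤ) | p) * V.rootNumber = 1 := by rw [← hrootW, hw]
  have hpsT : ps * T = (ps * δ) * ls := by rw [hT]; ring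
  have hb : ∀ ℓ : ℕ, ℓ.Prime → ℓ ∣ V.conductorNorm ℤ → ℓ ≠ 2 → J(ps * T | ℓ) = 1 := by
    intro ℓ hℓ hℓN hℓ2
    have hℓW : ℓ ∣ W.conductorNorm ℤ := hℓN.trans hNVW
    have hℓp : ℓ ≠ p := by rintro rfl; exact hpNV hℓN
    have hJ' : J(ls | ℓ) = J(ps * e₂ | ℓ) := by
      have := hJℓ₀ ℓ ((hScrt_mem ℓ).mpr ⟨hℓ, hℓW.mul_right _, hℓ2⟩)
      simp only [hη, hℓp, if_false] at this
      exact this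
    have hdKℓ : J(dK | ℓ) = 1 := by
      rw [hdK]
      exact (Quadratic.ncard_primesOver_eq_two_iff_jacobiSym hK.1 hℓ hℓ2).mp (hsplit ℓ hℓ hℓW hℓ2)
    have hpsℓ : ¬ (ℓ : ℤ) ∣ ps := fun hd ↦ hℓp (eq_of_prime_dvd_pStar (p := p) hℓ hd)
    have e1 : J(ps * T | ℓ) = J(ps * δ | ℓ) * J(ls | ℓ) := by
      rw [hpsT]; exact jacobiSym.mul_left _ _ _
    have e2 : J(ps * δ | ℓ) = J(ps | ℓ) * J(δ | ℓ) := jacobiSym.mul_left _ _ _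
    have e3 : J(ps * e₂ | ℓ) = J(ps | ℓ) * J(e₂ | ℓ) := jacobiSym.mul_left _ _ _
    have e4 : J(e₂ * δ | ℓ) = J(e₂ | ℓ) * J(δ | ℓ) := jacobiSym.mul_left _ _ _
    have hsq := jacobiSym_mul_self_eq_one hℓ hpsℓ
    have hqδ1 : J(e₂ | ℓ) * J(δ | ℓ) = 1 := by rw [← e4, ← hfac, hdKℓ]
    rw [e1, hJ', e2, e3]
    calc J(ps | ℓ) * J(δ | ℓ) * (J(ps | ℓ) * J(e₂ | ℓ))
        = (J(ps | ℓ) * J(ps | ℓ)) * (J(e₂ | ℓ) * J(δ | ℓ)) := by ring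
      _ = 1 := by rw [hsq, hqδ1, one_mul]
  have h8' : (ps * T) % 8 = 1 := by
    have e : ps * T = ps * δ * ls := by rw [hT]; ring
    rw [e]; exact h8ℓ₀
  have h8 : 2 ∣ V.conductorNorm ℤ → (ps * T) % 8 = 1 := fun _ ↦ h8'
  have hneg : ps * T < 0 := by
    rw [hpsT, hls, hσℓ₀, hσ]
    have habs : (ps * δ) * Int.sign (ps * δ) = ((ps * δ).natAbs : ℤ) := Int.mul_sign_self (ps * δ)
    have hpos : (0 : ℤ) < (ps * δ).natAbs := by exact_mod_cast Int.natAbs_pos.mpr hpsδ0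
    have hℓ₀pos : (0 : ℤ) < ℓ₀ := by exact_mod_cast hℓ₀.pos
    nlinarith [habs, hpos, hℓ₀pos]
  obtain ⟨X, iX, iXm, CX, hCX⟩ := exists_isGloballyMinimal_smul_eq_quadraticTwist V hTq
  haveI := V.isElliptic_quadraticTwist hTq
  have hXroot : X.rootNumber = -1 := by
    have hgcd : Int.gcd T (V.conductorNorm ℤ) = 1 := by
      rw [Int.gcd_eq_natAbs, Int.natAbs_natCast]
      refine Nat.coprime_of_dvd fun ℓ hℓ hℓT hℓN ↦ ?_
      have hℓT' : (ℓ : ℤ) ∣ T := by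
        have := Int.natAbs_dvd_natAbs.mp (by simpa using hℓT : (ℓ : ℤ).natAbs ∣ T.natAbs); exact this
      rw [hT] at hℓT'
      rcases Int.Prime.dvd_mul' hℓ hℓT' with h | h
      · exact hδgood ℓ hℓ h (hℓN.trans hNVW)
      · have h' : ℓ ∣ ls.natAbs := by simpa using Int.natAbs_dvd_natAbs.mpr h
        rw [hls, natAbs_pStar] at h'
        rw [(Nat.prime_dvd_prime_iff_eq hℓ hℓ₀).mp h'] at hℓN
        exact hℓ₀NW (hℓN.trans hNVW)
    have hTsq : Squarefree T := by
      rw [hT, squarefree_mul_iff]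
      refine ⟨?_, hδsq, ?_⟩
      · refine (Int.isCoprime_iff_gcd_eq_one.mpr ?_).isRelPrime
        rw [Int.gcd_eq_natAbs, hls, natAbs_pStar]
        exact Nat.Coprime.symm ((Nat.Prime.coprime_iff_not_dvd hℓ₀).mpr fun h ↦
          hℓ₀δ (Int.natAbs_dvd_natAbs.mp (by simpa using h)))
      · rw [hls]; exact (haveI := Fact.mk hℓ₀; squarefree_pStar (p := ℓ₀))
    obtain ⟨hrootX, -⟩ := V.rootNumber_quadraticTwist_of_emod_four_eq_one hmod hT4 hTsq hgcd
    rw [← hCX, X.rootNumber_smul_holds CX] at hrootX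
    -- wait: `(CX • X).rootNumber = X.rootNumber`; we need `X.rootNumber = (V.qT T).rootNumber`
    rw [hrootX]
    exact jacobiSym_rootNumber_sign hp.out hp2 hT4 hNV0 hVroot h1 hb h8 hneg
  refine ⟨V, iV, iVm, C', e₂, δ, ℓ₀, X, iX, iXm, CX, hC', hordV, hNWV, he₂, hfac, hδ4, hδsq, hδ2, hpδ, hδ0, hℓ₀, hℓ₀p,
    hℓ₀2, hℓ₀M, hℓ₀δ, hℓ₀dK, h8ℓ₀, fun ℓ hℓ hℓM hℓ2 hℓp ↦ ?_, hT4, hneg, hb, h8', hCX, hXroot⟩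
  have := hJℓ₀ ℓ ((hScrt_mem ℓ).mpr ⟨hℓ, hℓM, hℓ2⟩)
  simp only [hη, hℓp, if_false] at this
  exact this

end AuxTwistTwo

/-! ### §4 The `p`-ramified Kolyvagin class at the Wan prime `2` (E356 (d)) -/

section ClassTwo

variable (W : WeierstrassCurve ℚ) [W.IsElliptic] [W.IsGloballyMinimal] (p : ℕ) [hp : Fact p.Prime]
  (K : Type) [Field K] [NumberField K] {Wd : WeierstrassCurve ℚ} [Wd.IsElliptic]

set_option maxHeartbeats 800000 in
/-- **FIELD 2 at the Wan prime `2`, step 2 — the `p`-ramified Kolyvagin class and its rank-zero good-ordinary partner `A`**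
(the `q = 2` port of `exists_ramifiedClass_partner`): `d_{K''} = p*·e₂·ℓ₀*·d` is an EVEN fundamental discriminant (`2` ramified in
`K''`), every prime `ℓ ∉ {2, p}` of `N_E N_{Wd}` splits in `K''`, the common primes of `d_{K''}` and `N_E N_{Wd}` are `p, 2`, the free
prime is `ℓ₀`, and `u = p*Td` is `≡ 1 (mod 8)` and a square at every odd bad prime `≠ p` of `E`.
[cite: FriedbergHoffstein1995, Thm. B (1), as applied in JetchevSkinnerWan2017 §7.4.1] [cite: SilvermanAEC2009, X.5 Cor. 5.4 and App. C §16]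
[cite: Cox2013, §1.C Lemma 1.14 and (2.6)] -/
theorem exists_ramifiedClass_partner_two
    (hFH : friedbergHoffstein_exists_heegnerField_splitDivisors_twist_ne_zero)
    (hmod : exists_isNewformOf) (hL : hasEntireLFunction_rat)
    (hp5 : 5 ≤ p) (hw : W.rootNumber = 1) (hcell : N10.CellGordTwo W p) (hsurj : Surj W p)
    (hK : IsImaginaryQuadratic K) (h2d : (2 : ℤ) ∣ NumberField.discr K)
    (hsplit : ∀ ℓ : ℕ, ℓ.Prime → ℓ ∣ W.conductorNorm ℤ → ℓ ≠ 2 →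
      ((Ideal.span {(ℓ : ℤ)}).primesOver (𝓞 K)).ncard = 2)
    (Cd : VariableChange ℚ) (hWd : Cd • W.quadraticTwist (NumberField.discr K : ℚ) = Wd) :
    ∃ (ℓ₀ : ℕ) (e₂ T d : ℤ) (K'' : Type) (_ : Field K'') (_ : NumberField K'')
      (A : WeierstrassCurve ℚ) (_ : A.IsElliptic) (_ : A.IsGloballyMinimal),
      ℓ₀.Prime ∧ ℓ₀ ≠ p ∧ ℓ₀ ≠ 2 ∧ ¬ ℓ₀ ∣ Wd.conductorNorm ℤ ∧
      (e₂ = -4 ∨ e₂ = 8 ∨ e₂ = -8) ∧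
      NumberField.discr K'' =
        ((-1 : ℤ) ^ (p / 2) * p) * e₂ * ((-1 : ℤ) ^ (ℓ₀ / 2) * ℓ₀) * d ∧
      IsImaginaryQuadratic K'' ∧
      (∀ ℓ : ℕ, ℓ.Prime → ℓ ∣ W.conductorNorm ℤ * Wd.conductorNorm ℤ → ℓ ≠ p → ℓ ≠ 2 →
        SatisfiesHeegnerHypothesis ℓ K'') ∧
      (∀ ℓ : ℕ, ℓ.Prime → (ℓ : ℤ) ∣ NumberField.discr K'' →
        ℓ ∣ W.conductorNorm ℤ * Wd.conductorNorm ℤ → ℓ = p ∨ ℓ = 2) ∧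
      (∃ C : VariableChange ℚ, C • Wd.quadraticTwist (NumberField.discr K'' : ℚ) = A) ∧
      (∃ C : VariableChange ℚ, C • W.quadraticTwist ((((-1 : ℤ) ^ (p / 2) * p) * T * d : ℤ) : ℚ) = A) ∧
      (((-1 : ℤ) ^ (p / 2) * p) * T * d) % 4 = 1 ∧ Squarefree (((-1 : ℤ) ^ (p / 2) * p) * T * d) ∧
      (∀ ℓ : ℕ, ℓ.Prime → ℓ ∣ W.conductorNorm ℤ → ℓ ≠ p →
        (ℓ = 2 → (((-1 : ℤ) ^ (p / 2) * p) * T * d) % 8 = 1) ∧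
        (ℓ ≠ 2 → J(((-1 : ℤ) ^ (p / 2) * p) * T * d | ℓ) = 1)) ∧
      A.analyticRank = 0 ∧ GoodOrd A p ∧ Surj A p := by
  have hp2 : p ≠ 2 := by omega
  obtain ⟨V, iV, iVm, C', e₂, δ, ℓ₀, X, iX, iXm, CX, hC', hordV, hNWV, he₂, hfac, -, hδsq, -, hpδ, hδ0, hℓ₀,
      hℓ₀p, hℓ₀2, hℓ₀M, hℓ₀δ, -, h8ℓ₀, hJsplit, hT4, hneg, hb, h8, hCX, hXroot⟩ :=
    exists_auxTwist_two W p K hmod hp5 hw hcell hK h2d hsplit (Wd.conductorNorm ℤ)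
      (Wd.conductorNorm_pos_holds).ne'
  have he₂0' : e₂ ≠ 0 := by rcases he₂ with h | h | h <;> rw [h] <;> norm_num
  have he₂8 : e₂ ∣ 8 := by rcases he₂ with h | h | h <;> rw [h] <;> norm_num
  -- notation
  set ps : ℤ := (-1 : ℤ) ^ (p / 2) * p with hps
  set ls : ℤ := (-1 : ℤ) ^ (ℓ₀ / 2) * ℓ₀ with hls
  set T : ℤ := δ * ls with hT
  set dK : ℤ := NumberField.discr K with hdK
  clear_value dK
  have hdK0 : dK ≠ 0 := by rw [hdK]; exact NumberField.discr_ne_zero K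
  have hdKneg : dK < 0 := by rw [hdK]; exact hK.discr_neg
  have hNW0 : W.conductorNorm ℤ ≠ 0 := (W.conductorNorm_pos_holds).ne'
  have hNWd0 : Wd.conductorNorm ℤ ≠ 0 := (Wd.conductorNorm_pos_holds).ne'
  set M : ℕ := W.conductorNorm ℤ * Wd.conductorNorm ℤ with hM
  have hM0 : M ≠ 0 := mul_ne_zero hNW0 hNWd0
  have hℓ₀NW : ¬ ℓ₀ ∣ W.conductorNorm ℤ := fun h ↦ hℓ₀M (h.mul_right _)
  have hℓ₀NWd : ¬ ℓ₀ ∣ Wd.conductorNorm ℤ := fun h ↦ hℓ₀M (h.mul_left _)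
  have hls4 : ls % 4 = 1 := (haveI := Fact.mk hℓ₀; pStar_emod_four (p := ℓ₀) hℓ₀2)
  have hps4 : ps % 4 = 1 := pStar_emod_four (p := p) hp2
  have hT0 : T ≠ 0 := by rintro h; rw [h] at hT4; norm_num at hT4
  have hTq : (T : ℚ) ≠ 0 := by exact_mod_cast hT0
  haveI := V.isElliptic_quadraticTwist hTq
  -- §e Friedberg–Hoffstein on `X`
  set SFH : Finset ℕ := (2 * p * ℓ₀ * M * dK.natAbs).primeFactors with hSFH
  have hSFH0 : 2 * p * ℓ₀ * M * dK.natAbs ≠ 0 := by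
    refine mul_ne_zero (mul_ne_zero (mul_ne_zero (mul_ne_zero two_ne_zero
      hp.out.ne_zero) hℓ₀.ne_zero) hM0) (Int.natAbs_ne_zero.mpr hdK0)
  have hSFH_mem : ∀ ℓ : ℕ, ℓ.Prime → ℓ ∣ 2 * p * ℓ₀ * M * dK.natAbs → ℓ ∈ SFH := fun ℓ hℓ hd ↦
    Nat.mem_primeFactors.mpr ⟨hℓ, hd, hSFH0⟩
  obtain ⟨d, hdneg, hdsq, hd8, -, hdS, hdX, hLd⟩ :=
    exists_neg_fundamental_twist_ne_zero_of_friedbergHoffstein hFH X hXroot SFH 0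
  have hd0 : d ≠ 0 := hdneg.ne
  have hdq0 : (d : ℚ) ≠ 0 := by exact_mod_cast hd0
  have hd4 : d % 4 = 1 := by omega
  -- `(d/ℓ) = 1`, hence `ℓ ∤ d`, for every odd prime of `2 p ℓ₀ M d_K`
  have hdJ : ∀ ℓ : ℕ, ℓ.Prime → ℓ ∣ 2 * p * ℓ₀ * M * dK.natAbs → ℓ ≠ 2 → J(d | ℓ) = 1 :=
    fun ℓ hℓ hd h2 ↦ hdS ℓ (hSFH_mem ℓ hℓ hd) hℓ h2
  have hd_ndvd : ∀ ℓ : ℕ, ℓ.Prime → ℓ ∣ 2 * p * ℓ₀ * M * dK.natAbs → ¬ (ℓ : ℤ) ∣ d := by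
    intro ℓ hℓ hd
    by_cases h2 : ℓ = 2
    · subst h2; intro h; omega
    · exact not_dvd_of_jacobiSym_eq_one hℓ (hdJ ℓ hℓ hd h2)
  have hpd : ¬ (p : ℤ) ∣ d := hd_ndvd p hp.out ⟨2 * ℓ₀ * M * dK.natAbs, by ring⟩
  have hℓ₀d : ¬ (ℓ₀ : ℤ) ∣ d := hd_ndvd ℓ₀ hℓ₀ ⟨2 * p * M * dK.natAbs, by ring⟩
  -- §f the partner `A`, a globally minimal model of `X^{(d)}`
  haveI := X.isElliptic_quadraticTwist hdq0
  obtain ⟨A, iA, iAm, CA, hCA⟩ := exists_isGloballyMinimal_smul_eq_quadraticTwist X hdq0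
  have hrA : A.analyticRank = 0 := by
    rw [← analyticRank_smul A CA, hCA]
    exact ((X.quadraticTwist (d : ℚ)).analyticRank_eq_zero_iff_holds (hL _)).2 hLd
  -- §g the twist relations
  have hps0' : ps ≠ 0 := by
    rw [hps]; exact mul_ne_zero (pow_ne_zero _ (by norm_num)) (by exact_mod_cast hp.out.ne_zero)
  set u : ℤ := ps * T * d with hu
  have hAV : ∃ C : VariableChange ℚ, C • A = V.quadraticTwist ((T * d : ℤ) : ℚ) := by
    obtain ⟨C₃, hC₃⟩ : ∃ C₃ : VariableChange ℚ, C₃ = ⟨CX⁻¹.u, (d : ℚ) * CX⁻¹.r, 0, 0⟩ := ⟨_, rfl⟩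
    have hX : X = CX⁻¹ • V.quadraticTwist (T : ℚ) := by rw [← hCX, inv_smul_smul]
    have hparam : ((T : ℚ)) * (d : ℚ) = ((T * d : ℤ) : ℚ) := by push_cast; ring
    have e1 : X.quadraticTwist (d : ℚ) = C₃ • V.quadraticTwist ((T * d : ℤ) : ℚ) := by
      rw [hX, WeierstrassCurve.quadraticTwist_smul, quadraticTwist_quadraticTwist, ← hC₃, hparam]
    refine ⟨C₃⁻¹ * CA, ?_⟩
    rw [mul_smul, hCA, e1, inv_smul_smul]
  have hAW : ∃ C : VariableChange ℚ, C • W.quadraticTwist ((u : ℤ) : ℚ) = A := by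
    obtain ⟨C₁, hC₁⟩ := hAV
    -- `W^{(u)} ≅ V^{(ps u)} = V^{(T d ps²)} ≅ V^{(T d)} ≅ A`
    obtain ⟨C'', hC''⟩ : ∃ C'' : VariableChange ℚ, C'' = ⟨C'.u, ((u : ℤ) : ℚ) * C'.r, 0, 0⟩ :=
      ⟨_, rfl⟩
    have hparam : ((-1 : ℚ) ^ (p / 2) * (p : ℚ)) * ((u : ℤ) : ℚ) =
        ((T * d : ℤ) : ℚ) * ((ps : ℤ) : ℚ) ^ 2 := by
      rw [hu, hps]; push_cast; ring
    have e1 : W.quadraticTwist ((u : ℤ) : ℚ) =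
        C'' • V.quadraticTwist (((T * d : ℤ) : ℚ) * ((ps : ℤ) : ℚ) ^ 2) := by
      rw [← hC', WeierstrassCurve.quadraticTwist_smul, quadraticTwist_quadraticTwist, ← hC'', hparam]
    have hps0 : ((ps : ℤ) : ℚ) ≠ 0 := by exact_mod_cast hps0'
    obtain ⟨C₂, hC₂⟩ := V.exists_variableChange_quadraticTwist_mul_sq (((T * d : ℤ) : ℚ)) _ hps0
    have e2 : W.quadraticTwist ((u : ℤ) : ℚ) = (C'' * C₂ * C₁) • A := by
      rw [e1, ← hC₂, ← hC₁, mul_smul, mul_smul]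
    exact ⟨(C'' * C₂ * C₁)⁻¹, by rw [e2, inv_smul_smul]⟩
  -- §h the discriminant `d'' = p* e₂ ℓ₀* d` (an EVEN fundamental discriminant) and the field `K''`
  set D : ℤ := ps * e₂ * ls * d with hD
  have hpse₂ls_pos : 0 < ps * e₂ * ls := by
    -- `(ps e₂ ls) δ² = (ps δ ls)(e₂ δ) = (ps T)(d_K) > 0`
    have he₂δ : e₂ * δ < 0 := by rw [← hfac]; exact hdKneg
    have h1' : 0 < (ps * T) * (e₂ * δ) := mul_pos_of_neg_of_neg hneg he₂δ
    have e : (ps * T) * (e₂ * δ) = (ps * e₂ * ls) * (δ * δ) := by rw [hT]; ring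
    rw [e] at h1'
    have hδ2 : 0 < δ * δ := mul_self_pos.mpr hδ0
    exact (pos_iff_pos_of_mul_pos h1').mpr hδ2
  have hDneg : D < 0 := by rw [hD]; exact mul_neg_of_pos_of_neg hpse₂ls_pos hdneg
  -- `D / 4 = (e₂ / 4) · m` with `m = p* ℓ₀* d ≡ 1 (mod 4)` odd and square-free
  set m : ℤ := ps * ls * d with hm
  have hm4 : m % 4 = 1 := by
    rw [hm, Int.mul_emod, show (ps * ls) % 4 = 1 by rw [Int.mul_emod, hps4, hls4]; decide, hd4]; decide
  have hm2 : ¬ (2 : ℤ) ∣ m := by intro h; omega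
  have hmsq : Squarefree m := by
    -- `|m| = p ℓ₀ |d|` with `p, ℓ₀` distinct primes not dividing the square-free `d`
    rw [← Int.squarefree_natAbs]
    have hmabs : m.natAbs = p * ℓ₀ * d.natAbs := by
      rw [hm, Int.natAbs_mul, Int.natAbs_mul, hps, hls, natAbs_pStar, natAbs_pStar (p := ℓ₀)]
    rw [hmabs]
    have hcop1 : Nat.Coprime (p * ℓ₀) d.natAbs := by
      refine Nat.Coprime.mul_left ?_ ?_
      · exact (Nat.Prime.coprime_iff_not_dvd hp.out).mpr fun h ↦
          hpd (Int.natAbs_dvd_natAbs.mp (by simpa using h))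
      · exact (Nat.Prime.coprime_iff_not_dvd hℓ₀).mpr fun h ↦
          hℓ₀d (Int.natAbs_dvd_natAbs.mp (by simpa using h))
    rw [Nat.squarefree_mul hcop1]
    refine ⟨?_, Int.squarefree_natAbs.mpr hdsq⟩
    rw [Nat.squarefree_mul ((Nat.coprime_primes hp.out hℓ₀).mpr (Ne.symm hℓ₀p))]
    exact ⟨hp.out.prime.squarefree, hℓ₀.prime.squarefree⟩
  have h2msq : Squarefree (2 * m) := by
    rw [squarefree_mul_iff]
    refine ⟨?_, Int.prime_two.squarefree, hmsq⟩
    refine (Int.isCoprime_iff_gcd_eq_one.mpr ?_).isRelPrime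
    rw [Int.gcd_eq_natAbs]
    exact (Nat.Prime.coprime_iff_not_dvd Nat.prime_two).mpr fun h ↦
      hm2 (Int.natAbs_dvd_natAbs.mp (by simpa using h))
  have hsq_neg : ∀ x : ℤ, Squarefree x → Squarefree (-x) := fun x hx ↦ by
    rw [← Int.squarefree_natAbs, Int.natAbs_neg, Int.squarefree_natAbs]; exact hx
  have hDfund : 4 ∣ D ∧ (D / 4 % 4 = 2 ∨ D / 4 % 4 = 3) ∧ Squarefree (D / 4) := by
    rcases he₂ with h | h | h
    · have hD' : D = 4 * (-m) := by rw [hD, hm, h]; ring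
      have hq4 : D / 4 = -m := by rw [hD']; exact Int.mul_ediv_cancel_left _ (by norm_num)
      refine ⟨⟨-m, hD'⟩, ?_, ?_⟩
      · rw [hq4]; right; omega
      · rw [hq4]; exact hsq_neg m hmsq
    · have hD' : D = 4 * (2 * m) := by rw [hD, hm, h]; ring
      have hq4 : D / 4 = 2 * m := by rw [hD']; exact Int.mul_ediv_cancel_left _ (by norm_num)
      refine ⟨⟨2 * m, hD'⟩, ?_, ?_⟩
      · rw [hq4]; left; omega
      · rw [hq4]; exact h2msq
    · have hD' : D = 4 * (-(2 * m)) := by rw [hD, hm, h]; ring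
      have hq4 : D / 4 = -(2 * m) := by rw [hD']; exact Int.mul_ediv_cancel_left _ (by norm_num)
      refine ⟨⟨-(2 * m), hD'⟩, ?_, ?_⟩
      · rw [hq4]; left; omega
      · rw [hq4]; exact hsq_neg _ h2msq
  obtain ⟨K'', iF'', iN'', h2'', hdisc''⟩ :=
    Quadratic.exists_numberField_discr_eq (D := D) (Or.inr hDfund)
  have hK'' : IsImaginaryQuadratic K'' := isImaginaryQuadratic_of_discr_eq_of_neg h2'' hdisc'' hDneg
  -- §i `A ≅ Wd^{(d'')}`: `d_K · D = e₂² · u`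
  have hAWd : ∃ C : VariableChange ℚ, C • Wd.quadraticTwist (NumberField.discr K'' : ℚ) = A := by
    obtain ⟨C₁, hC₁⟩ := hAW
    obtain ⟨C₄, hC₄⟩ : ∃ C₄ : VariableChange ℚ, C₄ = ⟨Cd.u, ((D : ℤ) : ℚ) * Cd.r, 0, 0⟩ := ⟨_, rfl⟩
    have hparam : ((dK : ℤ) : ℚ) * ((D : ℤ) : ℚ) = ((u : ℤ) : ℚ) * ((e₂ : ℤ) : ℚ) ^ 2 := by
      have hdKfac : dK = e₂ * δ := hfac
      rw [hdKfac, hD, hu, hT]; push_cast; ring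
    have e1 : Wd.quadraticTwist ((D : ℤ) : ℚ) =
        C₄ • W.quadraticTwist (((u : ℤ) : ℚ) * ((e₂ : ℤ) : ℚ) ^ 2) := by
      rw [← hWd, WeierstrassCurve.quadraticTwist_smul, quadraticTwist_quadraticTwist, ← hC₄, hparam]
    have he₂0 : ((e₂ : ℤ) : ℚ) ≠ 0 := by exact_mod_cast he₂0'
    obtain ⟨C₂, hC₂⟩ := W.exists_variableChange_quadraticTwist_mul_sq (((u : ℤ) : ℚ)) _ he₂0
    have hWu : W.quadraticTwist ((u : ℤ) : ℚ) = C₁⁻¹ • A := by rw [← hC₁, inv_smul_smul]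
    have e2 : Wd.quadraticTwist ((D : ℤ) : ℚ) = (C₄ * C₂ * C₁⁻¹) • A := by
      rw [e1, ← hC₂, hWu, smul_smul, smul_smul]
    refine ⟨(C₄ * C₂ * C₁⁻¹)⁻¹, ?_⟩
    rw [hdisc'', e2, inv_smul_smul]
  -- §j good ordinary at `p`, surjective at `p`
  have hTd_sq : Squarefree (T * d) := by
    rw [squarefree_mul_iff]
    refine ⟨?_, ?_, hdsq⟩
    · refine (Int.isCoprime_iff_gcd_eq_one.mpr ?_).isRelPrime
      rw [Int.gcd_eq_natAbs]
      refine Nat.coprime_of_dvd fun ℓ hℓ hℓT hℓd ↦ hd_ndvd ℓ hℓ ?_ (Int.natAbs_dvd_natAbs.mp (by simpa using hℓd))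
      have hℓT' : (ℓ : ℤ) ∣ T := Int.natAbs_dvd_natAbs.mp (by simpa using hℓT)
      rw [hT] at hℓT'
      rcases Int.Prime.dvd_mul' hℓ hℓT' with h | h
      · -- `ℓ ∣ δ ∣ d_K`
        have hℓdK : ℓ ∣ dK.natAbs := by
          have := h.trans (⟨e₂, by rw [mul_comm]; exact hfac⟩ : δ ∣ dK)
          simpa using Int.natAbs_dvd_natAbs.mpr this
        exact hℓdK.mul_left _
      · have h' : ℓ ∣ ls.natAbs := by simpa using Int.natAbs_dvd_natAbs.mpr h
        rw [hls, natAbs_pStar] at h'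
        rw [(Nat.prime_dvd_prime_iff_eq hℓ hℓ₀).mp h']
        exact ⟨2 * p * M * dK.natAbs, by ring⟩
    · rw [hT, squarefree_mul_iff]
      refine ⟨?_, hδsq, ?_⟩
      · refine (Int.isCoprime_iff_gcd_eq_one.mpr ?_).isRelPrime
        rw [Int.gcd_eq_natAbs, hls, natAbs_pStar]
        exact Nat.Coprime.symm ((Nat.Prime.coprime_iff_not_dvd hℓ₀).mpr fun h ↦
          hℓ₀δ (Int.natAbs_dvd_natAbs.mp (by simpa using h)))
      · rw [hls]; exact (haveI := Fact.mk hℓ₀; squarefree_pStar (p := ℓ₀))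
  have hpTd : ¬ (p : ℤ) ∣ T * d := by
    intro h
    rcases Int.Prime.dvd_mul' hp.out h with h | h
    · rw [hT] at h
      rcases Int.Prime.dvd_mul' hp.out h with h | h
      · exact hpδ h
      · have h' : p ∣ ls.natAbs := by simpa using Int.natAbs_dvd_natAbs.mpr h
        rw [hls, natAbs_pStar] at h'
        exact hℓ₀p ((Nat.prime_dvd_prime_iff_eq hp.out hℓ₀).mp h').symm
    · exact hpd h
  have hgoA : GoodOrd A p := by
    obtain ⟨C₁, hC₁⟩ := hAV
    have hord : IsOrdinaryAt A p :=
      isOrdinaryAt_of_smul_eq_quadraticTwist V A hTd_sq hC₁ p hp2 hpTd ⟨hordV.1, hordV.2⟩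
    exact ⟨hord.1, hord.2⟩
  have hu0 : u ≠ 0 := by rw [hu]; exact mul_ne_zero (mul_ne_zero hps0' hT0) hd0
  have huq : ((u : ℤ) : ℚ) ≠ 0 := by exact_mod_cast hu0
  have hsurjA : Surj A p := (Additive.surj_iff_of_model_twist W p huq hAW).mpr hsurj
  -- §k arithmetic of `u = p* T d`
  have hu4 : u % 4 = 1 := by
    rw [hu, Int.mul_emod, show (ps * T) % 4 = 1 by rw [Int.mul_emod, hps4, hT4]; decide, hd4]; decide
  have husq : Squarefree u := by
    rw [hu, mul_assoc, squarefree_mul_iff]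
    refine ⟨?_, squarefree_pStar, hTd_sq⟩
    refine (Int.isCoprime_iff_gcd_eq_one.mpr ?_).isRelPrime
    rw [Int.gcd_eq_natAbs, hps, natAbs_pStar]
    exact (Nat.Prime.coprime_iff_not_dvd hp.out).mpr fun h ↦
      hpTd (Int.natAbs_dvd_natAbs.mp (by simpa using h))
  have hJu : ∀ ℓ : ℕ, ℓ.Prime → ℓ ∣ W.conductorNorm ℤ → ℓ ≠ p →
      (ℓ = 2 → u % 8 = 1) ∧ (ℓ ≠ 2 → J(u | ℓ) = 1) := by
    intro ℓ hℓ hℓW hℓp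
    have hℓV : ℓ ∣ V.conductorNorm ℤ := by
      rw [hNWV] at hℓW
      rcases (Nat.Prime.dvd_mul hℓ).mp hℓW with h | h
      · exact h
      · exact (hℓp ((Nat.prime_dvd_prime_iff_eq hℓ hp.out).mp (hℓ.dvd_of_dvd_pow h))).elim
    refine ⟨fun h2 ↦ ?_, fun h2 ↦ ?_⟩
    · subst h2
      rw [hu, Int.mul_emod, h8, hd8]; decide
    · rw [hu, jacobiSym.mul_left, hb ℓ hℓ hℓV h2,
        hdJ ℓ hℓ ((hℓW.mul_right (Wd.conductorNorm ℤ)).trans ⟨2 * p * ℓ₀ * dK.natAbs, by rw [hM]; ring⟩) h2]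
      norm_num
  -- §l splitting and ramification in `K''`
  have hsplit'' : ∀ ℓ : ℕ, ℓ.Prime → ℓ ∣ M → ℓ ≠ p → ℓ ≠ 2 → SatisfiesHeegnerHypothesis ℓ K'' := by
    intro ℓ hℓ hℓM hℓp hℓ2
    refine (satisfiesHeegnerHypothesis_iff_kronecker ℓ K'' h2'').mpr fun r hr hrℓ ↦ ?_
    obtain rfl : r = ℓ := (Nat.prime_dvd_prime_iff_eq hr hℓ).mp hrℓ
    rw [hdisc'']
    refine ⟨fun h2 ↦ (hℓ2 h2).elim, fun h2 ↦ ?_⟩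
    have hJls : J(ls | r) = J(ps * e₂ | r) := hJsplit r hr hℓM h2 hℓp
    have hJd : J(d | r) = 1 := hdJ r hr (hℓM.trans ⟨2 * p * ℓ₀ * dK.natAbs, by ring⟩) h2
    have hne₂ : ¬ (r : ℤ) ∣ ps * e₂ := by
      intro hd
      rcases Int.Prime.dvd_mul' hr hd with hd | hd
      · exact hℓp (eq_of_prime_dvd_pStar (p := p) hr hd)
      · have h8 : (r : ℤ) ∣ 8 := hd.trans he₂8
        have h8' : r ∣ 2 ^ 3 := by exact_mod_cast h8
        exact h2 ((Nat.prime_dvd_prime_iff_eq hr Nat.prime_two).mp (hr.dvd_of_dvd_pow h8'))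
    rw [hD, jacobiSym.mul_left, jacobiSym.mul_left, hJls, hJd, mul_one]
    exact jacobiSym_mul_self_eq_one hr hne₂
  have hram'' : ∀ ℓ : ℕ, ℓ.Prime → (ℓ : ℤ) ∣ NumberField.discr K'' → ℓ ∣ M → ℓ = p ∨ ℓ = 2 := by
    intro ℓ hℓ hℓD hℓM
    rw [hdisc'', hD] at hℓD
    rcases Int.Prime.dvd_mul' hℓ hℓD with h | h
    · rcases Int.Prime.dvd_mul' hℓ h with h | h
      · rcases Int.Prime.dvd_mul' hℓ h with h | h
        · exact Or.inl (eq_of_prime_dvd_pStar (p := p) hℓ h)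
        · have h8 : (ℓ : ℤ) ∣ 8 := h.trans he₂8
          have h8' : ℓ ∣ 2 ^ 3 := by exact_mod_cast h8
          exact Or.inr ((Nat.prime_dvd_prime_iff_eq hℓ Nat.prime_two).mp (hℓ.dvd_of_dvd_pow h8'))
      · exact (hℓ₀M ((haveI := Fact.mk hℓ₀; eq_of_prime_dvd_pStar (p := ℓ₀) hℓ h) ▸ hℓM)).elim
    · exact (hd_ndvd ℓ hℓ (hℓM.trans ⟨2 * p * ℓ₀ * dK.natAbs, by ring⟩) h).elim
  refine ⟨ℓ₀, e₂, T, d, K'', iF'', iN'', A, iA, iAm, hℓ₀, hℓ₀p, hℓ₀2, hℓ₀NWd, he₂, ?_, hK'', hsplit'', hram'',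
    hAWd, hAW, hu4, husq, hJu, hrA, hgoA, hsurjA⟩
  rw [hdisc'', hD]

/-! ### §5 FIELD 2 assembled at the Wan prime `2` (E356 (e)) and the typed supply -/

set_option maxHeartbeats 800000 in
/-- **FIELD 2 of the r0 twin at the Wan prime `2`** (verbatim port of `exists_fieldTwo_gordTwo` with `q := 2`): a `p`-RAMIFIED Kolyvagin
field `K''` for `(Wd, A)` with `2` ramified and a free ramified prime, and a globally minimal `A ≅ Wd^{(d_{K''})}` of analytic rank `0`,
good ordinary at `p`, `ρ̄_{A,p}` onto, non-split multiplicative at `2` with `p ∤ v₂(Δ_A)`, and `p ∤ ∏ c(A)`.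
[cite: FriedbergHoffstein1995, Thm. B (1), as applied in JetchevSkinnerWan2017 §7.4.1] [cite: SilvermanAEC2009, X.5 Cor. 5.4, VII.5.1 and Thm VII.6.1] -/
theorem exists_fieldTwo_gordTwo_two
    (hFH : friedbergHoffstein_exists_heegnerField_splitDivisors_twist_ne_zero)
    (hmod : exists_isNewformOf) (hL : hasEntireLFunction_rat)
    (hp5 : 5 ≤ p) (hw : W.rootNumber = 1) (hcell : N10.CellGordTwo W p) (hsurj : Surj W p)
    (htam : ¬ p ∣ W.tamagawaProduct)
    (h2p : 2 ≠ p) (h2m : W.HasMultiplicativeReductionAtPrime 2)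
    (h2ns : ¬ W.HasSplitMultiplicativeReductionAtPrime 2)
    (h2v : ¬ p ∣ padicValInt 2 W.minimalDiscriminantInt)
    (hK : IsImaginaryQuadratic K) (h2d : (2 : ℤ) ∣ NumberField.discr K)
    (hsplit : ∀ ℓ : ℕ, ℓ.Prime → ℓ ∣ W.conductorNorm ℤ → ℓ ≠ 2 →
      ((Ideal.span {(ℓ : ℤ)}).primesOver (𝓞 K)).ncard = 2)
    (Cd : VariableChange ℚ) (hWd : Cd • W.quadraticTwist (NumberField.discr K : ℚ) = Wd) :
    ∃ (K'' : Type) (_ : Field K'') (_ : NumberField K'')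
      (A : WeierstrassCurve ℚ) (_ : A.IsElliptic) (_ : A.IsGloballyMinimal),
      (IsImaginaryQuadratic K'' ∧ (p : ℤ) ∣ NumberField.discr K'' ∧
        (∀ ℓ : ℕ, ℓ.Prime → ℓ ∣ Wd.conductorNorm ℤ → ¬ (ℓ : ℤ) ∣ NumberField.discr K'' →
          SatisfiesHeegnerHypothesis ℓ K'') ∧
        (∀ ℓ : ℕ, (hℓ : ℓ.Prime) → ℓ ∣ Wd.conductorNorm ℤ → (ℓ : ℤ) ∣ NumberField.discr K'' → ℓ ≠ p →
          (haveI : Fact ℓ.Prime := ⟨hℓ⟩;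
            A.HasMultiplicativeReductionAtPrime ℓ ∧ ¬ A.HasSplitMultiplicativeReductionAtPrime ℓ))) ∧
      (∃ ℓ : ℕ, ℓ.Prime ∧ (ℓ : ℤ) ∣ NumberField.discr K'' ∧ ℓ ≠ p ∧ ¬ ℓ ∣ Wd.conductorNorm ℤ) ∧
      (∃ C : VariableChange ℚ, C • Wd.quadraticTwist (NumberField.discr K'' : ℚ) = A) ∧
      A.analyticRank = 0 ∧ GoodOrd A p ∧ Surj A p ∧
      (∃ ℓ : ℕ, ∃ _ : Fact ℓ.Prime, ℓ ≠ p ∧ A.HasMultiplicativeReductionAtPrime ℓ ∧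
        ¬ p ∣ padicValInt ℓ A.minimalDiscriminantInt) ∧
      ¬ p ∣ A.tamagawaProduct := by
  have hp2 : p ≠ 2 := by omega
  obtain ⟨ℓ₀, e₂, T, d, K'', iF'', iN'', A, iA, iAm, hℓ₀, hℓ₀p, hℓ₀2, hℓ₀NWd, he₂, hdisc, hK'', hsplit'', hram'',
      hAWd, ⟨Cu, hCu⟩, hu4, husq, hJu, hrA, hgoA, hsurjA⟩ :=
    exists_ramifiedClass_partner_two W p K hFH hmod hL hp5 hw hcell hsurj hK h2d hsplit Cd hWd
  have he₂2 : (2 : ℤ) ∣ e₂ := by rcases he₂ with h | h | h <;> rw [h] <;> norm_num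
  set u : ℤ := ((-1 : ℤ) ^ (p / 2) * p) * T * d with hu
  -- `u ≠ 0, 1`, `p ∣ u`
  have hpu : (p : ℤ) ∣ u := by
    rw [hu]
    refine Dvd.dvd.mul_right (Dvd.dvd.mul_right ?_ _) _
    exact Dvd.intro_left _ rfl
  have hu1 : u ≠ 1 := fun h ↦ by
    rw [h] at hpu
    exact hp.out.ne_one (by exact_mod_cast Int.eq_one_of_dvd_one (by norm_num) hpu)
  have hu0 : u ≠ 0 := fun h ↦ by rw [h] at hu4; norm_num at hu4
  have huq : ((u : ℤ) : ℚ) ≠ 0 := by exact_mod_cast hu0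
  -- squares at the bad primes `≠ p` of `E`
  have hsq : ∀ ℓ : ℕ, (hℓ : ℓ.Prime) → ℓ ∣ W.conductorNorm ℤ → ℓ ≠ p →
      (haveI : Fact ℓ.Prime := ⟨hℓ⟩; IsSquare (((u : ℤ) : ℚ) : ℚ_[ℓ])) := by
    intro ℓ hℓ hℓN hℓp
    haveI : Fact ℓ.Prime := ⟨hℓ⟩
    exact isSquare_padic_of_fundamental hu4 husq hu1 (hJu ℓ hℓ hℓN hℓp)
  -- at the Wan prime `2`
  have hqN : 2 ∣ W.conductorNorm ℤ :=
    (W.dvd_conductorNorm_iff_not_hasGoodReductionAtPrime 2).mpr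
      (not_hasGoodReductionAtPrime_of_hasMultiplicativeReductionAtPrime 2 h2m)
  have hsqq : IsSquare (((u : ℤ) : ℚ) : ℚ_[2]) := hsq 2 Nat.prime_two hqN h2p
  have hmultA : A.HasMultiplicativeReductionAtPrime 2 :=
    (X11b.mult_iff_of_twist W huq hsqq A hCu).mpr h2m
  have hnsA : ¬ A.HasSplitMultiplicativeReductionAtPrime 2 := by
    haveI := W.isElliptic_quadraticTwist huq
    rw [← hCu, hasSplitMultiplicativeReductionAtPrime_smul_iff,
      hasSplitMultiplicativeReductionAtPrime_quadraticTwist_iff W huq (by simpa using hsqq)]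
    exact h2ns
  have hΔq : padicValInt 2 A.minimalDiscriminantInt = padicValInt 2 W.minimalDiscriminantInt :=
    X11b.padicValInt_minimalDiscriminantInt_twist_eq W 2 huq (by simpa using hsqq) Cu hCu
  -- the Tamagawa product of `A`
  have hjA : A.j = W.j := AdditivePotMult.j_of_model_twist huq ⟨Cu, hCu⟩
  have htamA : ¬ p ∣ A.tamagawaProduct := by
    refine not_dvd_tamagawaProduct_of_forall A p fun v ↦ ?_
    set ℓ : ℕ := (primesEquiv v : ℕ) with hℓdef
    haveI hℓF : Fact ℓ.Prime := ⟨(primesEquiv v).2⟩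
    by_cases hcase : ℓ ∣ W.conductorNorm ℤ ∧ ℓ ≠ p
    · -- `A ⊗ ℚ_ℓ ≅ E ⊗ ℚ_ℓ`: same local Tamagawa number, and `p ∤ c_ℓ(E)`
      rw [localTamagawaNumber_eq_of_twist_of_isSquare W v (ℓ := ℓ) rfl huq
        (hsq ℓ hℓF.out hcase.1 hcase.2) A hCu]
      intro hdvd
      apply htam
      set cW : HeightOneSpectrum (𝓞 ℚ) → ℕ := fun v =>
        (W.baseChange (v.adicCompletion ℚ)).localTamagawaNumber (v.adicCompletionIntegers ℚ) with hcW
      have hfin : (Function.mulSupport cW).Finite := W.mulSupport_localTamagawaNumber_finite_holds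
      rw [show W.tamagawaProduct = ∏ᶠ v, cW v from rfl,
        finprod_eq_prod_of_mulSupport_subset cW (s := hfin.toFinset) (by simp)]
      by_cases hv1 : cW v = 1
      · exfalso
        have : p ∣ 1 := by rw [← hv1]; exact hdvd
        exact hp.out.ne_one (Nat.dvd_one.mp this)
      · exact hdvd.trans (Finset.dvd_prod_of_mem cW (hfin.mem_toFinset.mpr hv1))
    · -- `A` is not split multiplicative at `v`: `c_v(A) ≤ 4 < p`
      obtain ⟨h1, -, h4⟩ := kodairaNeron_localTamagawaNumber A v
      have hns : ¬ A.HasSplitMultiplicativeReductionAt v := by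
        intro hsplitv
        have hmult := hsplitv.hasMultiplicativeReductionAt
        have hlt := one_lt_valuation_j v A hmult
        have hle : v.valuation ℚ A.j ≤ 1 := by
          by_cases hℓp : ℓ = p
          · -- `A` is good at `p`
            refine Additive.valuation_j_le_one_of_hasGoodReductionAt A v ?_
            refine (hasGoodReductionAtPrime_iff_hasGoodReductionAt_ringOfIntegers v A).mp ?_
            have hg : A.HasGoodReductionAtPrime p := hgoA.1
            have key : ∀ (n : ℕ) (i₁ : Fact n.Prime) (i₂ : Fact p.Prime), n = p →
                @HasGoodReductionAtPrime A p i₂ → @HasGoodReductionAtPrime A n i₁ := by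
              rintro n i₁ i₂ rfl h; exact h
            exact key _ _ _ hℓp hg
          · -- `E` is good at `ℓ ∤ N_E`, and `j(A) = j(E)`
            have hℓN : ¬ ℓ ∣ W.conductorNorm ℤ := fun h ↦ hcase ⟨h, hℓp⟩
            have hgood : W.HasGoodReductionAtPrime ℓ :=
              not_not.mp (mt (W.dvd_conductorNorm_iff_not_hasGoodReductionAtPrime ℓ).mpr hℓN)
            rw [hjA]
            exact Additive.valuation_j_le_one_of_hasGoodReductionAt W v
              ((hasGoodReductionAtPrime_iff_hasGoodReductionAt_ringOfIntegers v W).mp hgood)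
        exact (not_lt.mpr hle) hlt
      have hc4 := h4 hns
      intro hdvd
      have := Nat.le_of_dvd (by omega) hdvd
      omega
  refine ⟨K'', iF'', iN'', A, iA, iAm, ⟨hK'', ?_, ?_, ?_⟩, ⟨ℓ₀, hℓ₀, ?_, hℓ₀p, hℓ₀NWd⟩, hAWd, hrA,
    hgoA, hsurjA, ⟨2, inferInstance, h2p, hmultA, by rw [hΔq]; exact h2v⟩, htamA⟩
  · -- `p ∣ d_{K''}`
    rw [hdisc]
    exact Dvd.dvd.mul_right (Dvd.dvd.mul_right (Dvd.dvd.mul_right (Dvd.intro_left _ rfl) _) _) _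
  · -- every prime of `N_{Wd}` off `d_{K''}` splits in `K''`
    intro ℓ hℓ hℓN hℓD
    have hℓp : ℓ ≠ p := by
      rintro rfl
      apply hℓD
      rw [hdisc]
      exact Dvd.dvd.mul_right (Dvd.dvd.mul_right (Dvd.dvd.mul_right (Dvd.intro_left _ rfl) _) _) _
    have hℓq : ℓ ≠ 2 := by
      rintro rfl
      apply hℓD
      rw [hdisc]
      exact Dvd.dvd.mul_right (Dvd.dvd.mul_right (Dvd.dvd.mul_left he₂2 _) _) _
    exact hsplit'' ℓ hℓ (hℓN.mul_left _) hℓp hℓq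
  · -- the common primes of `N_{Wd}` and `d_{K''}` other than `p`: only `2`, where `A` is non-split
    intro ℓ hℓ hℓN hℓD hℓp
    rcases hram'' ℓ hℓ hℓD (hℓN.mul_left _) with h | h
    · exact (hℓp h).elim
    · subst h
      exact ⟨hmultA, hnsA⟩
  · -- the free prime `ℓ₀ ∣ d_{K''}`
    rw [hdisc]
    exact Dvd.dvd.mul_right (Dvd.dvd.mul_left (Dvd.intro_left _ rfl) _) _

end ClassTwo

/-- **The typed supply `FieldTwoTwo` of the r0-twin workfile** (`WanAnyRoadPortR0.lean` §11), binder for binder. [composition] -/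
theorem fieldTwoTwo_supply :
  ∀ (W : WeierstrassCurve ℚ) [W.IsElliptic] [W.IsGloballyMinimal] (p : ℕ) [Fact p.Prime]
    (K : Type) [Field K] [NumberField K] (Wd : WeierstrassCurve ℚ) [Wd.IsElliptic] [Wd.IsGloballyMinimal],
    friedbergHoffstein_exists_heegnerField_splitDivisors_twist_ne_zero → exists_isNewformOf → hasEntireLFunction_rat →
    5 ≤ p → W.rootNumber = 1 → N10.CellGordTwo W p → Surj W p → ¬ p ∣ W.tamagawaProduct →
    2 ≠ p → W.HasMultiplicativeReductionAtPrime 2 → ¬ W.HasSplitMultiplicativeReductionAtPrime 2 →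
    ¬ p ∣ padicValInt 2 W.minimalDiscriminantInt →
    IsImaginaryQuadratic K → (2 : ℤ) ∣ NumberField.discr K →
    (∀ ℓ : ℕ, ℓ.Prime → ℓ ∣ W.conductorNorm ℤ → ℓ ≠ 2 → ((Ideal.span {(ℓ : ℤ)}).primesOver (𝓞 K)).ncard = 2) →
    (∃ C : VariableChange ℚ, C • W.quadraticTwist (NumberField.discr K : ℚ) = Wd) →
    ∃ (K'' : Type) (_ : Field K'') (_ : NumberField K'')
      (A : WeierstrassCurve ℚ) (_ : A.IsElliptic) (_ : A.IsGloballyMinimal),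
      (IsImaginaryQuadratic K'' ∧ (p : ℤ) ∣ NumberField.discr K'' ∧
        (∀ ℓ : ℕ, ℓ.Prime → ℓ ∣ Wd.conductorNorm ℤ → ¬ (ℓ : ℤ) ∣ NumberField.discr K'' →
          SatisfiesHeegnerHypothesis ℓ K'') ∧
        (∀ ℓ : ℕ, (hℓ : ℓ.Prime) → ℓ ∣ Wd.conductorNorm ℤ → (ℓ : ℤ) ∣ NumberField.discr K'' → ℓ ≠ p →
          (haveI : Fact ℓ.Prime := ⟨hℓ⟩;
            A.HasMultiplicativeReductionAtPrime ℓ ∧ ¬ A.HasSplitMultiplicativeReductionAtPrime ℓ))) ∧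
      (∃ ℓ : ℕ, ℓ.Prime ∧ (ℓ : ℤ) ∣ NumberField.discr K'' ∧ ℓ ≠ p ∧ ¬ ℓ ∣ Wd.conductorNorm ℤ) ∧
      (∃ C : VariableChange ℚ, C • Wd.quadraticTwist (NumberField.discr K'' : ℚ) = A) ∧
      A.analyticRank = 0 ∧ GoodOrd A p ∧ Surj A p ∧
      (∃ ℓ : ℕ, ∃ _ : Fact ℓ.Prime, ℓ ≠ p ∧ A.HasMultiplicativeReductionAtPrime ℓ ∧
        ¬ p ∣ padicValInt ℓ A.minimalDiscriminantInt) ∧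
      ¬ p ∣ A.tamagawaProduct := by
  intro W _ _ p _ K _ _ Wd _ _ hFH hmod hL hp5 hw hcell hsurj htam h2p h2m h2ns h2v hK h2d hsplit hC
  obtain ⟨Cd, hWd⟩ := hC
  exact exists_fieldTwo_gordTwo_two W p K hFH hmod hL hp5 hw hcell hsurj htam h2p h2m h2ns h2v hK h2d hsplit Cd hWd


end Summit.BirchSwinnertonDyer.BirchSwinnertonDyer.Theorems.WanAnyRoad
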